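import Summits.HodgeConjecture.HodgeConjecture.Theorems.F0P3bArchDegOnePackage
import Summits.HodgeConjecture.HodgeConjecture.Theorems.F0P3bHolAntiholInequivalent
import Summits.HodgeConjecture.HodgeConjecture.Theorems.F0P3bStubT3aUnitaryAlongPOfHermitian
import Summits.HodgeConjecture.HodgeConjecture.Theorems.F0P3bStubT3aConjTypeFlip
import Summits.HodgeConjecture.HodgeConjecture.Theorems.F0P3bStubT3aConjCohUnitary
import Summits.HodgeConjecture.HodgeConjecture.Theorems.F0P3bStubW1KIntegration
import Summits.HodgeConjecture.HodgeConjecture.Theorems.F0P3bKovacevicTransports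
import Summits.HodgeConjecture.HodgeConjecture.Theorems.F0P3bStubW4ValueMap
import Literature.RepresentationTheory.BorelWallach2000.UpqConjugateModuleAxioms
import HarnessLib

/-!
# FLOOR-0 P3b «ENGINE local packets», line `F0_LocalAPackets` — EXPORT of the two EXITS (X1):
# `ArchAPacketRealised` and `ArchCohomologicalMembers` as THEOREMS of the tree, re-assembled from the ★ closers

Cell hodgecm-mathlib (D-0151), FLOOR 0, crux item H413 = stmt-HodgeConjecture-24833; sub-line `Cruxes/H413/Lines/F0_LocalAPackets.lean`
(edition 4.1, commit 0a3d504cab04, SORRY-FREE).  Row X1 of PLAN-P3b v6 §1 ∕ F0P3b-plan (g6) 2026-08-31T04:47:57Z: «EXPORT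
`Theorems/F0P3bArchCohomologicalMembers.lean :: archCohomologicalMembers_holds` — EXIT 2's statement VERBATIM re-assembled from the ★ closers WITHOUT
importing `Lines`, so F0P3-plan cites it by name» (director s347: `Theorems/` never imports `Cruxes/**/Lines/*`).  Author A-p10 (g17).  PROOF lane
(theorems only: no `def`, no `sorry`, no instance declaration, no notation, no named fact).

Content = the line's §3 chain `realised_some_sign → archAPacketRealised_of → archCohomologicalMembers_of_realised` copied token for token, with the
registered stubs replaced by their ★ closers:
* the T3a₁ realisation datum at Kovačević's ladder module `Z(3)` with the concrete `K`-action `kTypeRep ladderPlus.S` — W1 ★ p810789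
  `F0P3bStubW1KIntegration.stubW1KIntegration_holds` (A-p03), W2∕W3 ★ p810615 `F0P3bKovacevicTransports.stubW2IrredAdm_holds`∕`stubW3Hermitian_holds`
  (A-p10), W4 ★ p810748 `F0P3bStubW4ValueMap.stubW4ValueMap_holds` (B-p08);
* T3a₄ ★ p800244 `stubT3aUnitaryAlongPOfHermitian_holds`, T3a₅ ★ p800329 `stubT3aConjTypeFlip_holds`, T3a₆ ★ p800304 `stubT3aConjCohUnitary_holds`;
* the ★ J2-converse `upqTypeClasses_ne_bot_of_isLadderValueMap` (defs leaf), ★ `hol_antihol_inequivalent` (T6a purity) and ★ `stub_T6c_degOneTypeRigid`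
  (one class per type) of the T6 package.
Heads: `realisationDatum_ladderPlus` (the ∃-datum), `realised_some_sign_holds`, **`archAPacketRealised_holds`** (= EXIT 1 `ArchAPacketRealised` :300 VERBATIM),
**`archCohomologicalMembers_holds`** (= EXIT 2 `ArchCohomologicalMembers` :336 VERBATIM), `localAPacketsPackage_holds'` (EXIT 1 ∧ EXIT 2).

HONEST LABEL: HC_CM is proved only modulo the 7 printed citations until rung 0 closes; this file re-exports two kernel-closed exits of ONE floor-0 sub-line
(the deep trace identities (13.1.4)∕(12.3.3 (a)) of [Rogawski1990] are NOT here — they wait on P3a's `LocalTransferDatum`).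

## References
* [Rogawski1990] J. Rogawski, *Automorphic Representations of Unitary Groups in Three Variables*, Annals of Math. Studies 123 (1990) — §12.3 p. 178
  (`J^± = πⁿ(ξ^±_∞)`), Prop. 15.2.1 (b) (the cohomological unitary representations with `H¹ ≠ 0`).
* [BorelWallach2000] A. Borel, N. Wallach, *Continuous Cohomology, Discrete Subgroups, and Representations of Reductive Groups*, 2nd ed., AMS 2000 —
  II §4.1–4.2, VI Thm 4.11–4.12.
* [Kovacevic2021] D. Kovačević, *Unitary `(𝔤, K)`-modules of `SU(2,1)`*, Acta Math. Spalatensia 1 (2021) — §3–§4 (the ladder module `Z(3)`).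
-/

set_option autoImplicit false
set_option linter.dupNamespace false

noncomputable section

namespace Summit.HodgeConjecture.HodgeConjecture.Cruxes.H413.F0P3bArchCohomologicalMembers

open Literature.NumberTheory.Automorphic
open Literature.RepresentationTheory.BorelWallach2000
open Literature.RepresentationTheory.KonnoKonno2007 Literature.RepresentationTheory.KonnoKonno2007.RealDualPair
open Literature.RepresentationTheory.KonnoKonno2007.RealDualPair.UForm
open Summit.HodgeConjecture.HodgeConjecture.Cruxes.H413.F0P3bArchDegOnePackage
open Summit.HodgeConjecture.HodgeConjecture.Cruxes.H413.F0P3PNullMapIsCocycle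
open Summit.HodgeConjecture.HodgeConjecture.Cruxes.H413.F0P3bLocalAPacketsDefs
open Literature.RepresentationTheory.Kovacevic2021 Literature.RepresentationTheory.Kovacevic2021.SU21Datum
open Summit.HodgeConjecture.HodgeConjecture.Cruxes.H413.F0P3bU21Restriction
open Summit.HodgeConjecture.HodgeConjecture.Cruxes.H413.F0P3bKTypeIntegration (KIdx kvec kTypeRep)
open Summit.HodgeConjecture.HodgeConjecture.Cruxes.H413.F0P3bStubT3aUnitaryAlongPOfHermitian (stubT3aUnitaryAlongPOfHermitian_holds)
open Summit.HodgeConjecture.HodgeConjecture.Cruxes.H413.F0P3bStubT3aConjTypeFlip (stubT3aConjTypeFlip_holds)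
open Summit.HodgeConjecture.HodgeConjecture.Cruxes.H413.F0P3bStubT3aConjCohUnitary (stubT3aConjCohUnitary_holds)
open Summit.HodgeConjecture.HodgeConjecture.Cruxes.H413.F0P3bStubW1KIntegration (stubW1KIntegration_holds)
open Summit.HodgeConjecture.HodgeConjecture.Cruxes.H413.F0P3bKovacevicTransports (stubW2IrredAdm_holds stubW3Hermitian_holds)
open Summit.HodgeConjecture.HodgeConjecture.Cruxes.H413.F0P3bStubW4ValueMap (stubW4ValueMap_holds)

-- Mathlib idiom (as in `GKModules`, the `Upq*` files, the T6 package and the line): commutator bracket on `Module.End`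
attribute [local instance 100] LieRing.ofAssociativeRing

/-! ## §1 The T3a₁ realisation datum at Kovačević's ladder module (W1–W4 ★) -/

/-- **The ladder realisation datum** (the line's `StubT3aRealisationDatum` body, as a theorem): an irreducible admissible `(𝔲(2,1), K)`-module
with an invariant positive-definite Hermitian form and a ladder value map of some sign `δ = ±1` — namely Kovačević's `Z(3) = ladderPlus` with the
honest `𝔲(2,1)`-action `kovLie ladderPlus.ρ` and the concrete `K`-action `kTypeRep ladderPlus.S` (W1 ★ p810789, W2∕W3 ★ p810615, W4 ★ p810748).
[cite: Rogawski1990, §12.3; BorelWallach2000, VI Thm 4.11; Kovacevic2021, §3–§4] -/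
theorem realisationDatum_ladderPlus :
    ∃ (V : Type) (_ : AddCommGroup V) (_ : Module ℂ V) (ρK : Representation ℂ G21.maximalCompact V)
      (ρ𝔤 : G21.lie →ₗ⁅ℝ⁆ Module.End ℂ V) (_ : IsGKModule G21 ρK ρ𝔤),
      IsIrreducibleGK ρK ρ𝔤 ∧ IsAdmissibleGK ρK ∧ HasInvariantHermitianForm ρ𝔤 ∧
      ∃ (δ : ℤ) (φ : G21.lie →ₗ[ℝ] V), (δ = 1 ∨ δ = -1) ∧ IsLadderValueMap ρK ρ𝔤 δ φ := by
  obtain ⟨hirr, hadm⟩ := stubW2IrredAdm_holds stubW1KIntegration_holds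
  obtain ⟨δ, φ, hδ, hφ⟩ := stubW4ValueMap_holds
  exact ⟨ladderPlus.V, inferInstance, inferInstance, kTypeRep ladderPlus.S, kovLie ladderPlus.ρ, stubW1KIntegration_holds, hirr, hadm,
    stubW3Hermitian_holds, δ, φ, hδ, hφ⟩

/-! ## §2 EXIT 1 — `ArchAPacketRealised` -/

/-- **One sign realised**: from the realisation datum, T3a₄ (unitarity along `𝔭` from the Hermitian form, ★ p800244) and the ★ J2-converse, an
irreducible unitary cohomological module with a non-zero degree-one class of SOME type `δ = ±1`. [cite: Rogawski1990, Prop. 15.2.1 (b); BorelWallach2000, II §4.2] -/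
theorem realised_some_sign_holds :
    ∃ (δ : ℤ), (δ = 1 ∨ δ = -1) ∧
      ∃ (V : Type) (_ : AddCommGroup V) (_ : Module ℂ V) (ρK : Representation ℂ G21.maximalCompact V)
        (ρ𝔤 : G21.lie →ₗ⁅ℝ⁆ Module.End ℂ V) (h : IsCohUnitaryIrrep ρK ρ𝔤),
        upqTypeClasses ρK ρ𝔤 h.gk.ad_compat 1 δ ≠ ⊥ := by
  obtain ⟨V, _, _, ρK, ρ𝔤, hgk, hirr, hadm, hH, δ, φ, hδ, hφ⟩ := realisationDatum_ladderPlus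
  have hcoh : IsCohUnitaryIrrep ρK ρ𝔤 := ⟨hgk, hirr, hadm, stubT3aUnitaryAlongPOfHermitian_holds (Fin 2) (Fin 1) V ρ𝔤 hH⟩
  exact ⟨δ, hδ, V, _, _, ρK, ρ𝔤, hcoh, upqTypeClasses_ne_bot_of_isLadderValueMap ρK ρ𝔤 hgk hirr hδ hφ⟩

/-- **EXIT 1 · `ArchAPacketRealised` HOLDS** (the line's def :300 VERBATIM): for each sign `δ = ±1` there is an irreducible unitary cohomological
`(𝔲(2,1), K)`-module with a non-zero degree-one class of type `δ` — the realised sign, and the other one by conjugation (T3a₅ ★ p800329 flips the type,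
T3a₆ ★ p800304 preserves `IsCohUnitaryIrrep`). [cite: Rogawski1990, §12.3 p. 178, Prop. 15.2.1 (b); BorelWallach2000, II §4.2] -/
theorem archAPacketRealised_holds :
    ∀ δ : ℤ, (δ = 1 ∨ δ = -1) →
      ∃ (V : Type) (_ : AddCommGroup V) (_ : Module ℂ V) (ρK : Representation ℂ G21.maximalCompact V)
        (ρ𝔤 : G21.lie →ₗ⁅ℝ⁆ Module.End ℂ V) (h : IsCohUnitaryIrrep ρK ρ𝔤),
        upqTypeClasses ρK ρ𝔤 h.gk.ad_compat 1 δ ≠ ⊥ := by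
  obtain ⟨δ₀, hδ₀, V, _, _, ρK, ρ𝔤, hcoh, hne⟩ := realised_some_sign_holds
  have hcoh' : IsCohUnitaryIrrep (UpqConj.kAct ρK) (UpqConj.lieAct ρ𝔤) := stubT3aConjCohUnitary_holds (Fin 2) (Fin 1) V ρK ρ𝔤 hcoh
  have hne' : upqTypeClasses (UpqConj.kAct ρK) (UpqConj.lieAct ρ𝔤) hcoh'.gk.ad_compat 1 (-δ₀) ≠ ⊥ :=
    stubT3aConjTypeFlip_holds (Fin 2) (Fin 1) V ρK ρ𝔤 hcoh.gk hcoh'.gk δ₀ hne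
  intro δ hδ
  by_cases hd : δ = δ₀
  · subst hd
    exact ⟨V, _, _, ρK, ρ𝔤, hcoh, hne⟩
  · have hd' : δ = -δ₀ := by
      rcases hδ with rfl | rfl <;> rcases hδ₀ with rfl | rfl <;> simp_all
    subst hd'
    exact ⟨V, _, _, UpqConj.kAct ρK, UpqConj.lieAct ρ𝔤, hcoh', hne'⟩

/-! ## §3 EXIT 2 — `ArchCohomologicalMembers` -/

/-- **EXIT 2 · `ArchCohomologicalMembers` HOLDS** (the line's def :336 VERBATIM; the integrator's ENGINE-INTERFACES §2 `Prop`): there are irreducible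
unitary cohomological `(𝔲(2,1), K)`-modules `J⁺` (type `(1,0)`) and `J⁻` (type `(0,1)`), INEQUIVALENT (★ `hol_antihol_inequivalent`, T6a purity), and
every irreducible unitary cohomological module with a non-zero class of type `δ = ±1` is `(𝔤, K)`-equivalent to `J^δ` (★ `stub_T6c_degOneTypeRigid`,
one class per type) — «the cohomological unitary representations with `H¹ ≠ 0` are EXACTLY `J⁺`, `J⁻`».
[cite: Rogawski1990, Prop. 15.2.1 (b), §12.3 p. 178; BorelWallach2000, VI Thm 4.11] -/
theorem archCohomologicalMembers_holds :
    ∃ (Vp : Type) (_ : AddCommGroup Vp) (_ : Module ℂ Vp) (ρKp : Representation ℂ G21.maximalCompact Vp)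
      (ρ𝔤p : G21.lie →ₗ⁅ℝ⁆ Module.End ℂ Vp) (hp : IsCohUnitaryIrrep ρKp ρ𝔤p)
      (Vm : Type) (_ : AddCommGroup Vm) (_ : Module ℂ Vm) (ρKm : Representation ℂ G21.maximalCompact Vm)
      (ρ𝔤m : G21.lie →ₗ⁅ℝ⁆ Module.End ℂ Vm) (hm : IsCohUnitaryIrrep ρKm ρ𝔤m),
      upqTypeClasses ρKp ρ𝔤p hp.gk.ad_compat 1 1 ≠ ⊥ ∧ upqTypeClasses ρKm ρ𝔤m hm.gk.ad_compat 1 (-1) ≠ ⊥ ∧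
      ¬ AreGKEquivalent ρKp ρ𝔤p ρKm ρ𝔤m ∧
      ∀ (V : Type) [AddCommGroup V] [Module ℂ V] (ρK : Representation ℂ G21.maximalCompact V)
        (ρ𝔤 : G21.lie →ₗ⁅ℝ⁆ Module.End ℂ V) (h : IsCohUnitaryIrrep ρK ρ𝔤) (δ : ℤ), (δ = 1 ∨ δ = -1) →
        upqTypeClasses ρK ρ𝔤 h.gk.ad_compat 1 δ ≠ ⊥ →
          (δ = 1 ∧ AreGKEquivalent ρK ρ𝔤 ρKp ρ𝔤p) ∨ (δ = -1 ∧ AreGKEquivalent ρK ρ𝔤 ρKm ρ𝔤m) := by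
  obtain ⟨Vp, _, _, ρKp, ρ𝔤p, hp, hVp⟩ := archAPacketRealised_holds 1 (Or.inl rfl)
  obtain ⟨Vm, _, _, ρKm, ρ𝔤m, hm, hVm⟩ := archAPacketRealised_holds (-1) (Or.inr rfl)
  refine ⟨Vp, _, _, ρKp, ρ𝔤p, hp, Vm, _, _, ρKm, ρ𝔤m, hm, hVp, hVm,
    hol_antihol_inequivalent hp hm hVp hVm, ?_⟩
  intro V _ _ ρK ρ𝔤 h δ hδ hV
  rcases hδ with rfl | rfl
  · exact Or.inl ⟨rfl, stub_T6c_degOneTypeRigid V ρK ρ𝔤 h Vp ρKp ρ𝔤p hp 1 (Or.inl rfl) hV hVp⟩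
  · exact Or.inr ⟨rfl, stub_T6c_degOneTypeRigid V ρK ρ𝔤 h Vm ρKm ρ𝔤m hm (-1) (Or.inr rfl) hV hVm⟩

/-- **The package of the line: EXIT 1 ∧ EXIT 2** (= `LocalAPacketsPackage` :372 with both conjuncts unfolded), unconditional.
[cite: Rogawski1990, Prop. 15.2.1 (b)] -/
theorem localAPacketsPackage_holds' :
    (∀ δ : ℤ, (δ = 1 ∨ δ = -1) →
      ∃ (V : Type) (_ : AddCommGroup V) (_ : Module ℂ V) (ρK : Representation ℂ G21.maximalCompact V)
        (ρ𝔤 : G21.lie →ₗ⁅ℝ⁆ Module.End ℂ V) (h : IsCohUnitaryIrrep ρK ρ𝔤),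
        upqTypeClasses ρK ρ𝔤 h.gk.ad_compat 1 δ ≠ ⊥) ∧
    (∃ (Vp : Type) (_ : AddCommGroup Vp) (_ : Module ℂ Vp) (ρKp : Representation ℂ G21.maximalCompact Vp)
      (ρ𝔤p : G21.lie →ₗ⁅ℝ⁆ Module.End ℂ Vp) (hp : IsCohUnitaryIrrep ρKp ρ𝔤p)
      (Vm : Type) (_ : AddCommGroup Vm) (_ : Module ℂ Vm) (ρKm : Representation ℂ G21.maximalCompact Vm)
      (ρ𝔤m : G21.lie →ₗ⁅ℝ⁆ Module.End ℂ Vm) (hm : IsCohUnitaryIrrep ρKm ρ𝔤m),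
      upqTypeClasses ρKp ρ𝔤p hp.gk.ad_compat 1 1 ≠ ⊥ ∧ upqTypeClasses ρKm ρ𝔤m hm.gk.ad_compat 1 (-1) ≠ ⊥ ∧
      ¬ AreGKEquivalent ρKp ρ𝔤p ρKm ρ𝔤m ∧
      ∀ (V : Type) [AddCommGroup V] [Module ℂ V] (ρK : Representation ℂ G21.maximalCompact V)
        (ρ𝔤 : G21.lie →ₗ⁅ℝ⁆ Module.End ℂ V) (h : IsCohUnitaryIrrep ρK ρ𝔤) (δ : ℤ), (δ = 1 ∨ δ = -1) →
        upqTypeClasses ρK ρ𝔤 h.gk.ad_compat 1 δ ≠ ⊥ →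
          (δ = 1 ∧ AreGKEquivalent ρK ρ𝔤 ρKp ρ𝔤p) ∨ (δ = -1 ∧ AreGKEquivalent ρK ρ𝔤 ρKm ρ𝔤m)) :=
  ⟨archAPacketRealised_holds, archCohomologicalMembers_holds⟩

end Summit.HodgeConjecture.HodgeConjecture.Cruxes.H413.F0P3bArchCohomologicalMembers
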